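import Summits.QuantumFields.YangMills.Theorems.LuscherReductionTwistedTraceScalingMehlerGap
import HarnessLib

/-!
# C4 INNER, brick S (part 2c): the Mehler gap in BILINEAR form — `|Q(u,w) − λ₀ c₀(u)c₀(w)| ≤ λ₀ρ ‖u^⊥‖ ‖w^⊥‖`
# (lane A of S-BASE, crux `TwistedTraceScaling` stmt-QuantumFields-20203; sub-target C4, design note `pub/ym-fleet/ym-luscher-20007-p1/COARSE-DESIGN.md` §21.5 S/O)

The stiff block of the Born–Oppenheimer package couples DIFFERENT slow fibres `c ≠ c'` through the one-site kernel, so block O needs the Mehler gap for the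
bilinear form `Q(u,w) = ∫∫ u K w` with `u = v(c,·)`, `w = v(c',·)` both orthogonal to the stiff ground state, not only the quadratic form of `…MehlerGap`:
* §1 the orthogonal part `u^⊥ = u − c₀(u)·hR 0` (`c₀(u^⊥) = 0`, `‖u^⊥‖² = ‖u‖² − c₀(u)²`) and the decomposition ★ `Q(u,w) = Q(u^⊥,w^⊥) + λ₀ c₀(u) c₀(w)`
  (`K hR 0 = λ₀ hR 0`, `…MehlerForm`);
* §2 on the orthogonal complement: `0 ≤ Q(f,f) ≤ λ₀ρ‖f‖²` (`…MehlerGap`), hence by polarisation and normalisation ★★ `abs_mehlerForm_orth_le : |Q(u,w)| ≤ λ₀ρ‖u‖‖w‖`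
  for `u, w ⊥ hR 0`;
* §3 ★★★ `abs_mehlerForm_sub_ground_le : |Q(u,w) − λ₀ c₀(u)c₀(w)| ≤ λ₀ρ·√(‖u‖² − c₀(u)²)·√(‖w‖² − c₀(w)²)`.
HONEST FRAMING: classical `L²` spectral bound for a stub of a child of the CONDITIONAL reduction route (femto rung R2b1); not infinite volume, not a gap, not Clay.

## References
* A. Wipf, *Statistical Approach to Quantum Field Theory*, LNP 992, Springer 2021, §8.5.1 (8.58). [Wipf2021]
* G. B. Folland, *Harmonic Analysis in Phase Space*, Princeton UP 1989, §1.7 (vii). [Folland1989]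
-/

set_option autoImplicit false

open MvPolynomial Complex MeasureTheory Filter Topology
open scoped Real

namespace Summit.QuantumFields.YangMills.Theorems.FemtoTransferGap.Mehler

open Literature.Analysis.SegalBargmann Literature.Analysis.OperatorTheory

noncomputable section

variable {σ : Type*} [Fintype σ] [DecidableEq σ]

/-! ### §1 The part orthogonal to the ground state -/

/-- `u^⊥ = u − c₀(u) · hR 0`. [cite: Folland1989, §1.7 (vii)] -/
def orthPart (u : (σ → ℝ) → ℝ) : (σ → ℝ) → ℝ := u - hermCoeff u 0 • hR 0

/-- `u^⊥ ∈ L²`. [folklore] -/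
theorem memLp_orthPart {u : (σ → ℝ) → ℝ} (hu : MemLp u 2 (volume : Measure (σ → ℝ))) : MemLp (orthPart u) 2 (volume : Measure (σ → ℝ)) :=
  hu.sub ((memLp_hR 0).const_smul _)

/-- `u^⊥ = u − f_{{0}}` (the partial Hermite sum over `{0}`). [folklore] -/
theorem orthPart_eq_sub_hermSum (u : (σ → ℝ) → ℝ) : orthPart u = u - hermSum u {0} := by
  funext x; simp [orthPart, hermSum]

/-- `c₀(u^⊥) = 0`. [cite: Folland1989, §1.7 (vii)] -/
theorem hermCoeff_orthPart_zero {u : (σ → ℝ) → ℝ} (hu : MemLp u 2 (volume : Measure (σ → ℝ))) : hermCoeff (orthPart u) 0 = 0 := by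
  rw [hermCoeff, orthPart_eq_sub_hermSum]
  exact integral_sub_hermSum_mul_hR hu (Finset.mem_singleton_self 0)

/-- `‖u^⊥‖² = ‖u‖² − c₀(u)²`. [cite: Folland1989, §1.7 (vii)] -/
theorem integral_orthPart_sq {u : (σ → ℝ) → ℝ} (hu : MemLp u 2 (volume : Measure (σ → ℝ))) :
    ∫ x, orthPart u x ^ 2 = (∫ x, u x ^ 2) - hermCoeff u 0 ^ 2 := by
  rw [orthPart_eq_sub_hermSum, integral_sub_hermSum_sq hu, Finset.sum_singleton]

/-- ★ **Decomposition**: `Q(u,w) = Q(u^⊥,w^⊥) + λ₀ c₀(u) c₀(w)`. [cite: Wipf2021, §8.5.1 (8.56)–(8.58)] -/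
theorem mehlerForm_eq_orth_add_ground {a b : σ → ℝ} (ha : ∀ k, 0 < a k) (hb : ∀ k, 0 < b k) (hab : ∀ k, a k ^ 2 + 2 * a k * b k = π ^ 2)
    {u w : (σ → ℝ) → ℝ} (hu : MemLp u 2 (volume : Measure (σ → ℝ))) (hw : MemLp w 2 (volume : Measure (σ → ℝ))) :
    mehlerForm a b u w = mehlerForm a b (orthPart u) (orthPart w) + (∏ k, Real.sqrt (π / (a k + b k + π))) * hermCoeff u 0 * hermCoeff w 0 := by
  have hb' : ∀ k, 0 ≤ b k := fun k => (hb k).le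
  have hs : ∀ k, 0 < a k + b k + π := fun k => by have := Real.pi_pos; linarith [ha k, hb k]
  have hu' := memLp_orthPart hu
  have hw' := memLp_orthPart hw
  have h0 : MemLp (hermCoeff u 0 • hR (0 : σ →₀ ℕ)) 2 (volume : Measure (σ → ℝ)) := (memLp_hR 0).const_smul _
  have h0w : MemLp (hermCoeff w 0 • hR (0 : σ →₀ ℕ)) 2 (volume : Measure (σ → ℝ)) := (memLp_hR 0).const_smul _
  have eu : u = orthPart u + hermCoeff u 0 • hR 0 := by rw [orthPart, sub_add_cancel]
  have ew : w = orthPart w + hermCoeff w 0 • hR 0 := by rw [orthPart, sub_add_cancel]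
  -- the weight at `α = 0`
  have hwt0lam : (∏ k, Real.sqrt (π / (a k + b k + π))) * ∏ k, (b k / (a k + b k + π)) ^ ((0 : σ →₀ ℕ) k) = ∏ k, Real.sqrt (π / (a k + b k + π)) := by
    simp
  -- `Q(u^⊥, hR 0) = 0`, `Q(hR 0, w^⊥) = 0`, `Q(hR 0, hR 0) = λ₀`
  have h1 : mehlerForm a b (orthPart u) (hR 0) = 0 := by
    rw [mehlerForm_hR_right hs hab, hwt0lam]
    have : ∫ x, orthPart u x * hR 0 x = hermCoeff (orthPart u) 0 := rfl
    rw [this, hermCoeff_orthPart_zero hu, mul_zero]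
  have h2 : mehlerForm a b (hR 0) (orthPart w) = 0 := by
    rw [mehlerForm_comm ha hb' (memLp_hR 0) hw', mehlerForm_hR_right hs hab, hwt0lam]
    have : ∫ x, orthPart w x * hR 0 x = hermCoeff (orthPart w) 0 := rfl
    rw [this, hermCoeff_orthPart_zero hw, mul_zero]
  have h3 : mehlerForm a b (hR (0 : σ →₀ ℕ)) (hR 0) = ∏ k, Real.sqrt (π / (a k + b k + π)) := by
    rw [mehlerForm_hR_hR hs hab, if_pos rfl, hwt0lam]
  conv_lhs => rw [eu, ew]
  rw [mehlerForm_add_left ha hb' hu' h0 (hw'.add h0w), mehlerForm_add_right ha hb' hu' hw' h0w, mehlerForm_add_right ha hb' h0 hw' h0w,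
    mehlerForm_smul_right, mehlerForm_smul_right, mehlerForm_smul_left, mehlerForm_smul_left, h1, h2, h3]
  ring

/-! ### §2 The form on the orthogonal complement -/

/-- On `(hR 0)^⊥`: `0 ≤ Q(f,f) ≤ λ₀ρ‖f‖²`. [cite: Wipf2021, §8.5.1 (8.58)] -/
theorem mehlerForm_orth_self_le {a b : σ → ℝ} (ha : ∀ k, 0 < a k) (hb : ∀ k, 0 < b k) (hab : ∀ k, a k ^ 2 + 2 * a k * b k = π ^ 2)
    {ρ : ℝ} (hρ0 : 0 ≤ ρ) (hρ : ∀ k, b k / (a k + b k + π) ≤ ρ) (hρ1 : ρ ≤ 1) {f : (σ → ℝ) → ℝ} (hf : MemLp f 2 (volume : Measure (σ → ℝ)))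
    (hf0 : hermCoeff f 0 = 0) :
    0 ≤ mehlerForm a b f f ∧ mehlerForm a b f f ≤ (∏ k, Real.sqrt (π / (a k + b k + π))) * ρ * ∫ x, f x ^ 2 := by
  refine ⟨mehlerForm_nonneg ha hb hab hf, ?_⟩
  have h := mehlerForm_le_gap ha hb hab hρ0 hρ hρ1 hf
  rw [hf0] at h
  simpa [mul_assoc] using h

omit [DecidableEq σ] in
/-- `c₀` is additive. [folklore] -/
theorem hermCoeff_add [DecidableEq σ] {u w : (σ → ℝ) → ℝ} (hu : MemLp u 2 (volume : Measure (σ → ℝ))) (hw : MemLp w 2 (volume : Measure (σ → ℝ)))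
    (α : σ →₀ ℕ) : hermCoeff (u + w) α = hermCoeff u α + hermCoeff w α := by
  unfold hermCoeff
  rw [← integral_add (integrable_mul_of_memLp hu (memLp_hR α)) (integrable_mul_of_memLp hw (memLp_hR α))]
  exact integral_congr_ae (ae_of_all _ fun x => by simp only [Pi.add_apply]; ring)

/-- `c₀` is homogeneous. [folklore] -/
theorem hermCoeff_smul (c : ℝ) (u : (σ → ℝ) → ℝ) (α : σ →₀ ℕ) : hermCoeff (c • u) α = c * hermCoeff u α := by
  unfold hermCoeff
  rw [← integral_const_mul]
  exact integral_congr_ae (ae_of_all _ fun x => by simp only [Pi.smul_apply, smul_eq_mul]; ring)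

omit [DecidableEq σ] in
/-- `‖c u‖² = c² ‖u‖²`. [folklore] -/
theorem integral_smul_sq (c : ℝ) (u : (σ → ℝ) → ℝ) : ∫ x, (c • u) x ^ 2 = c ^ 2 * ∫ x, u x ^ 2 := by
  rw [← integral_const_mul]
  exact integral_congr_ae (ae_of_all _ fun x => by simp only [Pi.smul_apply, smul_eq_mul]; ring)

omit [DecidableEq σ] in
/-- The quadratic expansion `Q(u + c w, u + c w) = Q(u,u) + 2c Q(u,w) + c² Q(w,w)`. [folklore] -/
theorem mehlerForm_add_smul_self {a b : σ → ℝ} (ha : ∀ k, 0 < a k) (hb : ∀ k, 0 ≤ b k) {u w : (σ → ℝ) → ℝ} (hu : MemLp u 2 (volume : Measure (σ → ℝ)))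
    (hw : MemLp w 2 (volume : Measure (σ → ℝ))) (c : ℝ) :
    mehlerForm a b (u + c • w) (u + c • w) = mehlerForm a b u u + 2 * c * mehlerForm a b u w + c ^ 2 * mehlerForm a b w w := by
  have hcw : MemLp (c • w) 2 (volume : Measure (σ → ℝ)) := hw.const_smul c
  rw [mehlerForm_add_left ha hb hu hcw (hu.add hcw), mehlerForm_add_right ha hb hu hu hcw, mehlerForm_add_right ha hb hcw hu hcw,
    mehlerForm_smul_right, mehlerForm_smul_left, mehlerForm_smul_left, mehlerForm_smul_right, mehlerForm_comm ha hb hw hu]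
  ring

omit [DecidableEq σ] in
/-- `‖u + c w‖² = ‖u‖² + 2c⟨u,w⟩ + c²‖w‖²`. [folklore] -/
theorem integral_add_smul_sq {u w : (σ → ℝ) → ℝ} (hu : MemLp u 2 (volume : Measure (σ → ℝ))) (hw : MemLp w 2 (volume : Measure (σ → ℝ))) (c : ℝ) :
    ∫ x, (u + c • w) x ^ 2 = (∫ x, u x ^ 2) + 2 * c * (∫ x, u x * w x) + c ^ 2 * ∫ x, w x ^ 2 := by
  have h1 : Integrable (fun x => u x ^ 2 + 2 * c * (u x * w x)) := hu.integrable_sq.add ((integrable_mul_of_memLp hu hw).const_mul _)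
  have e : (fun x => (u + c • w) x ^ 2) = fun x => (u x ^ 2 + 2 * c * (u x * w x)) + c ^ 2 * w x ^ 2 := by
    funext x; simp only [Pi.add_apply, Pi.smul_apply, smul_eq_mul]; ring
  rw [e, integral_add h1 (hw.integrable_sq.const_mul _), integral_add hu.integrable_sq ((integrable_mul_of_memLp hu hw).const_mul _),
    integral_const_mul, integral_const_mul]

/-- ★★ **Bilinear gap on the orthogonal complement**: for `u, w ⊥ hR 0`: `|Q(u,w)| ≤ λ₀ρ‖u‖₂‖w‖₂` (polarisation and normalisation).
[cite: Wipf2021, §8.5.1 (8.58)] -/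
theorem abs_mehlerForm_orth_le {a b : σ → ℝ} (ha : ∀ k, 0 < a k) (hb : ∀ k, 0 < b k) (hab : ∀ k, a k ^ 2 + 2 * a k * b k = π ^ 2)
    {ρ : ℝ} (hρ0 : 0 ≤ ρ) (hρ : ∀ k, b k / (a k + b k + π) ≤ ρ) (hρ1 : ρ ≤ 1) {u w : (σ → ℝ) → ℝ} (hu : MemLp u 2 (volume : Measure (σ → ℝ)))
    (hw : MemLp w 2 (volume : Measure (σ → ℝ))) (hu0 : hermCoeff u 0 = 0) (hw0 : hermCoeff w 0 = 0) :
    |mehlerForm a b u w| ≤ (∏ k, Real.sqrt (π / (a k + b k + π))) * ρ * (Real.sqrt (∫ x, u x ^ 2) * Real.sqrt (∫ x, w x ^ 2)) := by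
  set L := ∏ k, Real.sqrt (π / (a k + b k + π)) with hL
  have hL0 : 0 ≤ L := Finset.prod_nonneg fun k _ => Real.sqrt_nonneg _
  have hLρ : 0 ≤ L * ρ := mul_nonneg hL0 hρ0
  have hb' : ∀ k, 0 ≤ b k := fun k => (hb k).le
  set α := Real.sqrt (∫ x, u x ^ 2) with hα
  set β := Real.sqrt (∫ x, w x ^ 2) with hβ
  have hα0 : 0 ≤ α := Real.sqrt_nonneg _
  have hβ0 : 0 ≤ β := Real.sqrt_nonneg _
  -- Schur: `|Q(u,w)| ≤ M α β`; in particular `Q = 0` if `α = 0` or `β = 0`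
  have hSchur := abs_mehlerForm_le ha hb' hu hw
  rw [← hα, ← hβ] at hSchur
  by_cases hα00 : α = 0
  · have : |mehlerForm a b u w| ≤ 0 := by rw [hα00, zero_mul, mul_zero] at hSchur; exact hSchur
    rw [abs_nonpos_iff.mp this, abs_zero]; positivity
  by_cases hβ00 : β = 0
  · have : |mehlerForm a b u w| ≤ 0 := by rw [hβ00, mul_zero, mul_zero] at hSchur; exact hSchur
    rw [abs_nonpos_iff.mp this, abs_zero]; positivity
  have hαpos : 0 < α := lt_of_le_of_ne hα0 (Ne.symm hα00)
  have hβpos : 0 < β := lt_of_le_of_ne hβ0 (Ne.symm hβ00)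
  -- normalise: `ũ = u/α`, `w̃ = w/β`
  set ut : (σ → ℝ) → ℝ := α⁻¹ • u with hut
  set wt : (σ → ℝ) → ℝ := β⁻¹ • w with hwt
  have hutm : MemLp ut 2 (volume : Measure (σ → ℝ)) := hu.const_smul _
  have hwtm : MemLp wt 2 (volume : Measure (σ → ℝ)) := hw.const_smul _
  have hut0 : hermCoeff ut 0 = 0 := by rw [hut, hermCoeff_smul, hu0, mul_zero]
  have hwt0 : hermCoeff wt 0 = 0 := by rw [hwt, hermCoeff_smul, hw0, mul_zero]
  have hut1 : ∫ x, ut x ^ 2 = 1 := by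
    rw [hut, integral_smul_sq, ← Real.sq_sqrt (integral_nonneg fun x => sq_nonneg (u x)), ← hα, inv_pow, inv_mul_cancel₀ (pow_ne_zero 2 hαpos.ne')]
  have hwt1 : ∫ x, wt x ^ 2 = 1 := by
    rw [hwt, integral_smul_sq, ← Real.sq_sqrt (integral_nonneg fun x => sq_nonneg (w x)), ← hβ, inv_pow, inv_mul_cancel₀ (pow_ne_zero 2 hβpos.ne')]
  -- `ũ ± w̃ ⊥ hR 0`, `‖ũ ± w̃‖² = 2 ± 2⟨ũ,w̃⟩`, `|⟨ũ,w̃⟩| ≤ 1`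
  have hc : ∀ c : ℝ, hermCoeff (ut + c • wt) 0 = 0 := fun c => by
    rw [hermCoeff_add hutm (hwtm.const_smul c), hut0, zero_add, hermCoeff_smul, hwt0, mul_zero]
  have hn : ∀ c : ℝ, ∫ x, (ut + c • wt) x ^ 2 = 1 + 2 * c * (∫ x, ut x * wt x) + c ^ 2 := by
    intro c; rw [integral_add_smul_sq hutm hwtm, hut1, hwt1, mul_one]
  have hip : |∫ x, ut x * wt x| ≤ 1 := by
    have h1 : 0 ≤ ∫ x, (ut + (1 : ℝ) • wt) x ^ 2 := integral_nonneg fun x => sq_nonneg _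
    have h2 : 0 ≤ ∫ x, (ut + (-1 : ℝ) • wt) x ^ 2 := integral_nonneg fun x => sq_nonneg _
    rw [hn] at h1 h2
    rw [abs_le]; constructor <;> nlinarith
  -- polarisation: `4 Q(ũ,w̃) = Q(ũ+w̃) − Q(ũ−w̃)` with `0 ≤ Q(·,·) ≤ Lρ‖·‖²`
  have hQ : ∀ c : ℝ, 0 ≤ mehlerForm a b (ut + c • wt) (ut + c • wt) ∧
      mehlerForm a b (ut + c • wt) (ut + c • wt) ≤ L * ρ * (1 + 2 * c * (∫ x, ut x * wt x) + c ^ 2) := fun c => by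
    have h := mehlerForm_orth_self_le ha hb hab hρ0 hρ hρ1 (hutm.add (hwtm.const_smul c)) (hc c)
    rw [hn] at h
    exact h
  have hexp : ∀ c : ℝ, mehlerForm a b (ut + c • wt) (ut + c • wt) =
      mehlerForm a b ut ut + 2 * c * mehlerForm a b ut wt + c ^ 2 * mehlerForm a b wt wt := mehlerForm_add_smul_self ha hb' hutm hwtm
  have hQt : |mehlerForm a b ut wt| ≤ L * ρ := by
    obtain ⟨hp0, hp1⟩ := hQ 1
    obtain ⟨hm0, hm1⟩ := hQ (-1)
    rw [hexp] at hp0 hp1 hm0 hm1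
    have hi := abs_le.mp hip
    rw [abs_le]; constructor <;> nlinarith
  -- scale back: `Q(u,w) = α β Q(ũ,w̃)`
  have hscale : mehlerForm a b u w = α * β * mehlerForm a b ut wt := by
    have eu : u = α • ut := by rw [hut, smul_smul, mul_inv_cancel₀ hαpos.ne', one_smul]
    have ew : w = β • wt := by rw [hwt, smul_smul, mul_inv_cancel₀ hβpos.ne', one_smul]
    conv_lhs => rw [eu, ew]
    rw [mehlerForm_smul_left, mehlerForm_smul_right]; ring
  rw [hscale, abs_mul, abs_mul, abs_of_pos hαpos, abs_of_pos hβpos]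
  calc α * β * |mehlerForm a b ut wt| ≤ α * β * (L * ρ) := mul_le_mul_of_nonneg_left hQt (mul_nonneg hα0 hβ0)
    _ = L * ρ * (α * β) := by ring

/-! ### §3 ★★★ The bilinear gap -/

/-- ★★★ **BILINEAR MEHLER GAP**: `|Q(u,w) − λ₀ c₀(u) c₀(w)| ≤ λ₀ρ · √(‖u‖² − c₀(u)²) · √(‖w‖² − c₀(w)²)` for all real `u, w ∈ L²(ℝ^σ)` — the kernel is `λ₀` times
the ground-state projection plus an operator of norm `≤ λ₀ρ` on its orthogonal complement. [cite: Wipf2021, §8.5.1 (8.58)] [cite: Folland1989, §1.7 (vii)] -/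
theorem abs_mehlerForm_sub_ground_le {a b : σ → ℝ} (ha : ∀ k, 0 < a k) (hb : ∀ k, 0 < b k) (hab : ∀ k, a k ^ 2 + 2 * a k * b k = π ^ 2)
    {ρ : ℝ} (hρ0 : 0 ≤ ρ) (hρ : ∀ k, b k / (a k + b k + π) ≤ ρ) (hρ1 : ρ ≤ 1) {u w : (σ → ℝ) → ℝ} (hu : MemLp u 2 (volume : Measure (σ → ℝ)))
    (hw : MemLp w 2 (volume : Measure (σ → ℝ))) :
    |mehlerForm a b u w - (∏ k, Real.sqrt (π / (a k + b k + π))) * hermCoeff u 0 * hermCoeff w 0| ≤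
      (∏ k, Real.sqrt (π / (a k + b k + π))) * ρ * (Real.sqrt ((∫ x, u x ^ 2) - hermCoeff u 0 ^ 2) * Real.sqrt ((∫ x, w x ^ 2) - hermCoeff w 0 ^ 2)) := by
  rw [mehlerForm_eq_orth_add_ground ha hb hab hu hw, add_sub_cancel_right, ← integral_orthPart_sq hu, ← integral_orthPart_sq hw]
  exact abs_mehlerForm_orth_le ha hb hab hρ0 hρ hρ1 (memLp_orthPart hu) (memLp_orthPart hw) (hermCoeff_orthPart_zero hu) (hermCoeff_orthPart_zero hw)

end

end Summit.QuantumFields.YangMills.Theorems.FemtoTransferGap.Mehler
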